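import Literature.Geometry.GeometricMeasureTheory.SphericalMeasure
import Literature.Geometry.GeometricMeasureTheory.BlowUpTangentPlane
import HarnessLib

/-!
# The spherical measure under `1`-Lipschitz maps and on planes

Support file for the proof of the named fact
`Literature.Geometry.GeometricMeasureTheory.Federer1969_compactness_integralCurrents` along
B. White's structure-theorem-free proof of the closure theorem [White1989, Step 3, p. 218]
("since orthogonal projection does not increase area"; [Bandara2006, proof of Thm. 4.2.1, p. 43]).
The blow-up files (`BlowUpSheetMultiplicity`, `BlowUpTangentPlane`) run with a finite measure `σ`
carried by a set `M` under the *projection hypothesis*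
`𝓗^{k+1}(P_W A) ≤ σ(A)` for `A ⊆ M` and every `(k+1)`-plane `W`
(normalised Hausdorff measure `μHE[k+1]` on the left). This file discharges that hypothesis for
`σ = 𝓢^{k+1} ⌞ M`, the spherical measure of `SphericalMeasure.lean` (for which the sharp upper
density bound `Θ^{*(k+1)}(𝓢^{k+1} ⌞ M, ·) ≤ 1` is available):

* `sphericalGauge_image_le`, `sphericalMeasure_image_le` — a `1`-Lipschitz map does not increase
  the circumball gauge nor the spherical measure: `𝓢ⁿ(f A) ≤ 𝓢ⁿ(A)` [Federer1969, 2.10.11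
  ("in this argument `𝓗^m` can be replaced by `𝓢^m`")];
* `euclideanHausdorffMeasure_inter_le_sphericalGauge`,
  `euclideanHausdorffMeasure_le_sphericalMeasure_of_subset` — on an `n`-plane `W`, Lebesgue measure
  is below the spherical measure: `𝓛ⁿ_W(E) = μHE[n](E) ≤ 𝓢ⁿ(E)` for `E ⊆ W` (the easy half of
  [Federer1969, 2.10.35]: a set inside a ball `𝐁(x, r)` meets `W` in a set of `𝓛ⁿ_W`-measure at
  most `α(n) rⁿ`);
* `euclideanHausdorffMeasure_image_starProjection_le_sphericalMeasure`,
  `projection_le_sphericalMeasure_restrict` — the projection hypothesis for `σ = 𝓢^{k+1} ⌞ M`: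
  `μHE[k+1](P_W A) ≤ 𝓢^{k+1}(P_W A) ≤ 𝓢^{k+1}(A) = (𝓢^{k+1} ⌞ M)(A)` for `A ⊆ M`.

## References

* H. Federer, *Geometric Measure Theory*, Springer 1969, 2.10.2, 2.10.11, 2.10.35
  (held copy `lit book:federernd-geometric-measure-theory`, pp. 156, 172) [Federer1969].
* B. White, *A new proof of the compactness theorem for integral currents*, Comment. Math. Helv.
  64 (1989) 207–220, Step 3 [White1989].
* L. Bandara, *The closure theorem for integral currents without the structure theorem*,
  B.Sc. thesis, ANU 2006, proof of Thm. 4.2.1, p. 43 (held copy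
  `lit paper:galaxy-pdf-8023002039701172160`) [Bandara2006].
-/

noncomputable section

open scoped ENNReal NNReal Topology
open MeasureTheory TopologicalSpace Set Filter Metric Function

namespace Literature.Geometry.GeometricMeasureTheory

/-! ### `1`-Lipschitz maps do not increase `𝓢ⁿ` -/

section Lipschitz

variable {X Y : Type*} [MetricSpace X] [MetricSpace Y]

/-- A `1`-Lipschitz map does not increase the circumball gauge: `ζₙ(f S) ≤ ζₙ(S)` (an enclosing
ball `𝐁(x, r)` of `S` is mapped into the ball `𝐁(f x, r)` enclosing `f S`).
[cite: Federer1969, 2.10.11] -/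
theorem sphericalGauge_image_le {f : X → Y} (hf : LipschitzWith 1 f) (n : ℕ) (S : Set X) :
    sphericalGauge n (f '' S) ≤ sphericalGauge n S := by
  refine le_sphericalGauge_iff.2 fun x r hS =>
    sphericalGauge_le_of_subset_closedBall (x := f x) ?_
  rintro _ ⟨y, hy, rfl⟩
  rw [mem_closedBall]
  calc dist (f y) (f x) ≤ (1 : ℝ≥0) * dist y x := hf.dist_le_mul y x
    _ = dist y x := by rw [NNReal.coe_one, one_mul]
    _ ≤ r := mem_closedBall.1 (hS hy)

/-- A `1`-Lipschitz map does not increase the size-`δ` approximating pre-measures of `𝓢ⁿ`: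
`𝓢ⁿ_δ(f S) ≤ 𝓢ⁿ_δ(S)` (covers of `S` by sets of diameter `≤ δ` are mapped to such covers of
`f S`, with smaller gauge). [cite: Federer1969, 2.10.11] -/
theorem pre_sphericalGauge_image_le {f : X → Y} (hf : LipschitzWith 1 f) (n : ℕ) (δ : ℝ≥0∞)
    (S : Set X) :
    OuterMeasure.mkMetric'.pre (sphericalGauge (X := Y) n) δ (f '' S) ≤
      OuterMeasure.mkMetric'.pre (sphericalGauge (X := X) n) δ S := by
  have h : OuterMeasure.comap f (OuterMeasure.mkMetric'.pre (sphericalGauge (X := Y) n) δ) ≤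
      OuterMeasure.mkMetric'.pre (sphericalGauge (X := X) n) δ := by
    refine OuterMeasure.mkMetric'.le_pre.2 fun s hs => ?_
    rw [OuterMeasure.comap_apply]
    refine (OuterMeasure.mkMetric'.pre_le ?_).trans (sphericalGauge_image_le hf n s)
    exact (hf.ediam_image_le s).trans (by rwa [ENNReal.coe_one, one_mul])
  simpa only [OuterMeasure.comap_apply] using h S

variable [MeasurableSpace X] [BorelSpace X] [MeasurableSpace Y] [BorelSpace Y]

/-- **`1`-Lipschitz maps do not increase the spherical measure**: `𝓢ⁿ(f A) ≤ 𝓢ⁿ(A)` for every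
set `A` and every map `f` with `Lip f ≤ 1` (in particular for orthogonal projections).
[cite: Federer1969, 2.10.11] -/
theorem sphericalMeasure_image_le {f : X → Y} (hf : LipschitzWith 1 f) (n : ℕ) (A : Set X) :
    (sphericalMeasure n : Measure Y) (f '' A) ≤ (sphericalMeasure n : Measure X) A := by
  rw [sphericalMeasure_apply, sphericalMeasure_apply]
  simp only [OuterMeasure.mkMetric', OuterMeasure.iSup_apply]
  exact iSup₂_mono fun r _ => pre_sphericalGauge_image_le hf n r A

end Lipschitz

/-! ### Lebesgue measure of a plane is below the spherical measure -/

section Plane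

variable {V : Type*} [NormedAddCommGroup V] [InnerProductSpace ℝ V] [FiniteDimensional ℝ V]
  [MeasurableSpace V] [BorelSpace V] {k : ℕ}

/-- On a `(k+1)`-plane `W`, the part of any set `t` inside `W` has `𝓛^{k+1}_W`-measure at most
the circumball gauge of `t`: if `t ⊆ 𝐁(x, r)` then `t ∩ W ⊆ P_W⁻¹ 𝐁_W(P_W x, r) ∩ W`, a slab of
`W` of measure `α(k+1) r^{k+1}`. [cite: Federer1969, 2.10.35] -/
theorem euclideanHausdorffMeasure_inter_le_sphericalGauge (W : Submodule ℝ V)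
    (hdim : Module.finrank ℝ W = k + 1) (t : Set V) :
    (μHE[k + 1] : Measure V) (t ∩ W) ≤ sphericalGauge (k + 1) t := by
  haveI : Nontrivial W := Module.nontrivial_of_finrank_eq_succ hdim
  refine le_sphericalGauge_iff.2 fun x r ht => ?_
  rcases lt_or_ge r 0 with hr | hr
  · have ht0 : t = ∅ := subset_eq_empty ht (closedBall_eq_empty.2 hr)
    simp [ht0]
  set P := W.orthogonalProjectionOnto with hPdef
  have hsub : t ∩ (W : Set V) ⊆ P ⁻¹' closedBall (P x) r ∩ {y : V | y - 0 ∈ W} := by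
    rintro y ⟨hy, hyW⟩
    refine ⟨?_, by simpa using hyW⟩
    rw [mem_preimage, mem_closedBall, dist_eq_norm, ← map_sub]
    exact ((P.le_opNorm _).trans (mul_le_of_le_one_left (norm_nonneg _)
      (Submodule.orthogonalProjectionOnto_norm_le W))).trans (mem_closedBall_iff_norm.1 (ht hy))
  calc (μHE[k + 1] : Measure V) (t ∩ W)
      ≤ (μHE[k + 1] : Measure V) (P ⁻¹' closedBall (P x) r ∩ {y : V | y - 0 ∈ W}) :=
        measure_mono hsub
    _ = (μHE[k + 1] : Measure V).restrict {y : V | y - 0 ∈ W} (P ⁻¹' closedBall (P x) r) :=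
        (Measure.restrict_apply (measurableSet_closedBall.preimage P.continuous.measurable)).symm
    _ = volume (closedBall (P x) r) :=
        euclideanHausdorffMeasure_restrict_plane_preimage W hdim (Submodule.zero_mem _)
          measurableSet_closedBall
    _ = volume (ball (0 : W) r) := by
        rw [Measure.addHaar_closedBall_center, Measure.addHaar_closedBall_eq_addHaar_ball]
    _ = unitBallVolume (k + 1) * ENNReal.ofReal (r ^ (k + 1)) :=
        volume_ball_eq_unitBallVolume_mul W hdim hr
    _ = unitBallVolume (k + 1) * ENNReal.ofReal r ^ (k + 1) := by rw [ENNReal.ofReal_pow hr]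

/-- Consequently `𝓛^{k+1}_W = μHE[k+1] ⌞ W` is below every approximating pre-measure
`𝓢^{k+1}_δ` (whatever `δ`). [cite: Federer1969, 2.10.35] -/
theorem restrict_euclideanHausdorffMeasure_le_pre_sphericalGauge (W : Submodule ℝ V)
    (hdim : Module.finrank ℝ W = k + 1) (δ : ℝ≥0∞) (E : Set V) :
    (μHE[k + 1] : Measure V).restrict W E ≤
      OuterMeasure.mkMetric'.pre (sphericalGauge (X := V) (k + 1)) δ E := by
  have hW : MeasurableSet (W : Set V) := W.closed_of_finiteDimensional.measurableSet
  have h : ((μHE[k + 1] : Measure V).restrict W).toOuterMeasure ≤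
      OuterMeasure.mkMetric'.pre (sphericalGauge (X := V) (k + 1)) δ := by
    refine OuterMeasure.mkMetric'.le_pre.2 fun t _ => ?_
    rw [Measure.coe_toOuterMeasure, Measure.restrict_apply' hW]
    exact euclideanHausdorffMeasure_inter_le_sphericalGauge W hdim t
  exact h E

/-- **Lebesgue measure of a plane is below the spherical measure**: for `E ⊆ W`, `W` a
`(k+1)`-plane, `𝓛^{k+1}_W(E) = μHE[k+1](E) ≤ 𝓢^{k+1}(E)` (the easy half of
`𝓢^m = 𝓛^m` on `ℝ^m`). [cite: Federer1969, 2.10.35] -/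
theorem euclideanHausdorffMeasure_le_sphericalMeasure_of_subset (W : Submodule ℝ V)
    (hdim : Module.finrank ℝ W = k + 1) {E : Set V} (hE : E ⊆ W) :
    (μHE[k + 1] : Measure V) E ≤ (sphericalMeasure (k + 1) : Measure V) E := by
  have hW : MeasurableSet (W : Set V) := W.closed_of_finiteDimensional.measurableSet
  have h1 : (μHE[k + 1] : Measure V) E = (μHE[k + 1] : Measure V).restrict W E := by
    rw [Measure.restrict_apply' hW, inter_eq_self_of_subset_left hE]
  rw [h1]
  exact (restrict_euclideanHausdorffMeasure_le_pre_sphericalGauge W hdim 1 E).trans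
    (pre_le_sphericalMeasure (k + 1) one_pos E)

/-! ### The projection hypothesis for `σ = 𝓢^{k+1} ⌞ M` -/

/-- **Orthogonal projection does not increase area**, spherical-measure form: for every set `A`
and every `(k+1)`-plane `W`, `μHE[k+1](P_W A) ≤ 𝓢^{k+1}(A)` (`P_W A ⊆ W` has Lebesgue measure
`≤ 𝓢^{k+1}(P_W A)`, and `P_W` is `1`-Lipschitz). [cite: Federer1969, 2.10.11, 2.10.35;
White1989, p. 218] -/
theorem euclideanHausdorffMeasure_image_starProjection_le_sphericalMeasure (W : Submodule ℝ V)
    (hdim : Module.finrank ℝ W = k + 1) (A : Set V) :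
    (μHE[k + 1] : Measure V) (W.starProjection '' A) ≤ (sphericalMeasure (k + 1) : Measure V) A :=
  calc (μHE[k + 1] : Measure V) (W.starProjection '' A)
      ≤ (sphericalMeasure (k + 1) : Measure V) (W.starProjection '' A) :=
        euclideanHausdorffMeasure_le_sphericalMeasure_of_subset W hdim
          (by rintro _ ⟨x, -, rfl⟩; exact W.starProjection_apply_mem x)
    _ ≤ (sphericalMeasure (k + 1) : Measure V) A :=
        sphericalMeasure_image_le W.lipschitzWith_starProjection (k + 1) A

/-- **The projection hypothesis of the blow-up argument for `σ = 𝓢^{k+1} ⌞ M`**: for every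
`(k+1)`-plane `W` and every `A ⊆ M`, `μHE[k+1](P_W A) ≤ (𝓢^{k+1} ⌞ M)(A)` — the hypothesis
`hproj` of `blowUpLimit_eq_restrict_invariantSubspace` / `vagueTendsto_blowUp_of_good`.
[cite: White1989, p. 218; Bandara2006, proof of Thm. 4.2.1, p. 43] -/
theorem projection_le_sphericalMeasure_restrict (M : Set V) :
    ∀ W : Submodule ℝ V, Module.finrank ℝ W = k + 1 → ∀ A ⊆ M,
      (μHE[k + 1] : Measure V) (W.starProjection '' A) ≤
        ((sphericalMeasure (k + 1) : Measure V).restrict M) A := by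
  intro W hdim A hA
  calc (μHE[k + 1] : Measure V) (W.starProjection '' A)
      ≤ (sphericalMeasure (k + 1) : Measure V) A :=
        euclideanHausdorffMeasure_image_starProjection_le_sphericalMeasure W hdim A
    _ = (sphericalMeasure (k + 1) : Measure V) (A ∩ M) := by rw [inter_eq_self_of_subset_left hA]
    _ ≤ ((sphericalMeasure (k + 1) : Measure V).restrict M) A := Measure.le_restrict_apply _ _

omit [InnerProductSpace ℝ V] [FiniteDimensional ℝ V] in
/-- The restricted spherical measure `𝓢^{k+1} ⌞ M` is carried by `M` (`M` measurable): the
hypothesis `hM` of the blow-up files. [cite: Federer1969, 2.1.2] -/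
theorem sphericalMeasure_restrict_compl_eq_zero {M : Set V} (hM : MeasurableSet M) (n : ℕ) :
    ((sphericalMeasure n : Measure V).restrict M) Mᶜ = 0 := by
  rw [Measure.restrict_apply hM.compl, compl_inter_self, measure_empty]

end Plane

end Literature.Geometry.GeometricMeasureTheory
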